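import Summits.RiemannHypothesis.RiemannHypothesis.Theorems.UniversalFactorLaplaceLoopholeConvolution
import Literature.NumberTheory.LFunctions.XiIntegralProofs
import Literature.NumberTheory.LFunctions.DeBruijnHZeroProofs
import Mathlib.MeasureTheory.Group.Integral

/-!
# RiemannHypothesis / UniversalFactor — wide kernels: the tail `e^{ax} F_a(x) → a ∫₀^∞ H_0 cosh(a·)`

Route `RiemannHypothesis/UniversalFactor`, target `LaplaceLoophole` (stmt-RiemannHypothesis-2575), wide
window `0 < a < π/8` of its kill path.  With `H_0 = deBruijnH 0` (`= ξ(1/2 + iz/2)/8`) and the Laplace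
smoothing `F_a = deBruijnHDiv (1 + u²/a²) = H_0 ∗ (a/2)e^{−a|·|}`
(`deBruijnHDiv_laplace_ofReal_eq_conv`), we prove:

* `exists_norm_deBruijnH_zero_real_le_exp` — for every `b < π/8` there is `C` with
  `‖H_0(x)‖ ≤ C e^{−b|x|}` for all real `x` (from the PROVED Lagarias–Montague bound
  `|ξ(s)| ≤ C₁ e^{−π|t|/4}(|t|+1)^{5/2}` on `1/2 ≤ Re s ≤ 2`, `LagariasMontague2011_lem_3_3_i_holds`, and
  `deBruijnH_zero_eq_holds`);
* `integrable_exp_mul_deBruijnH_zero` — `w ↦ e^{aw} H_0(w)` is integrable over `ℝ` for `0 < a < π/8`,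
  and `integral_exp_mul_deBruijnH_zero` — `∫ℝ (a/2)e^{aw}H_0(w) dw = a ∫₀^∞ H_0(y) cosh(ay) dy`;
* `tendsto_exp_mul_deBruijnHDiv_laplace` and **`wideKernelTail : WideKernelTail`** (the route decl,
  item stmt-RiemannHypothesis-2581, verbatim): for `0 < a < π/8`,
  `e^{ax} F_a(x) → a ∫₀^∞ H_0(y) cosh(ay) dy` as `x → +∞`
  (dominated convergence in `e^{ax}F_a(x) = ∫ℝ (a/2) e^{ax − a|x − w|} H_0(w) dw`, majorant
  `(a/2) e^{aw} ‖H_0(w)‖`).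

So for wide kernels the real zeros of `F_a` are bounded as soon as the residue integral
`∫₀^∞ H_0 cosh(a·) ≠ 0` (used in `UniversalFactorLaplaceLoopholeWideNoGo.lean`).

References: E. C. Titchmarsh, *The theory of the Riemann zeta-function*, §10.1 (decay of `Ξ`);
J. C. Lagarias, D. Montague, Mosc. J. Comb. Number Theory 1 (2011), Lemma 3.3 (1).
-/

noncomputable section

open MeasureTheory Set Filter
open scoped Topology

namespace Summit.RiemannHypothesis.RiemannHypothesis.Theorems

open Literature.NumberTheory.LFunctions
open Summit.RiemannHypothesis.RiemannHypothesis.Theses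

/-! ## Decay of `H_0` on the real axis -/

/-- Polynomial factors are absorbed by exponentials: `(r/2 + 1)^{5/2} e^{−δr} ≤ (1 + 3/δ)³` for
`r ≥ 0`, `δ > 0`. [folklore] -/
theorem rpow_mul_exp_neg_le {δ : ℝ} (hδ : 0 < δ) {r : ℝ} (hr : 0 ≤ r) :
    (r / 2 + 1) ^ (5 / 2 : ℝ) * Real.exp (-(δ * r)) ≤ (1 + 3 / δ) ^ 3 := by
  have h1 : (r / 2 + 1) ^ (5 / 2 : ℝ) ≤ (r + 1) ^ (3 : ℝ) := by
    calc (r / 2 + 1) ^ (5 / 2 : ℝ) ≤ (r + 1) ^ (5 / 2 : ℝ) :=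
          Real.rpow_le_rpow (by positivity) (by linarith) (by norm_num)
      _ ≤ (r + 1) ^ (3 : ℝ) := Real.rpow_le_rpow_of_exponent_le (by linarith) (by norm_num)
  have h3 : (r + 1) ^ (3 : ℝ) = (r + 1) ^ 3 := by
    rw [show (3 : ℝ) = ((3 : ℕ) : ℝ) by norm_num, Real.rpow_natCast]
  -- `1 + r ≤ (1 + 3/δ) e^{δ r / 3}`
  have hexp1 : 1 ≤ Real.exp (δ * r / 3) := Real.one_le_exp (by positivity)
  have hexp2 : δ * r / 3 + 1 ≤ Real.exp (δ * r / 3) := Real.add_one_le_exp _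
  have hkey : r + 1 ≤ (1 + 3 / δ) * Real.exp (δ * r / 3) := by
    have : r = 3 / δ * (δ * r / 3) := by field_simp
    have h4 : 3 / δ * (δ * r / 3) ≤ 3 / δ * Real.exp (δ * r / 3) :=
      mul_le_mul_of_nonneg_left (by linarith) (by positivity)
    nlinarith
  have hkey3 : (r + 1) ^ 3 ≤ ((1 + 3 / δ) * Real.exp (δ * r / 3)) ^ 3 :=
    pow_le_pow_left₀ (by linarith) hkey 3
  have hexp3 : Real.exp (δ * r / 3) ^ 3 * Real.exp (-(δ * r)) = 1 := by
    rw [← Real.exp_nat_mul, ← Real.exp_add]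
    convert Real.exp_zero using 2
    push_cast
    ring
  calc (r / 2 + 1) ^ (5 / 2 : ℝ) * Real.exp (-(δ * r))
      ≤ (r + 1) ^ 3 * Real.exp (-(δ * r)) := by
        rw [← h3]; exact mul_le_mul_of_nonneg_right h1 (Real.exp_pos _).le
    _ ≤ ((1 + 3 / δ) * Real.exp (δ * r / 3)) ^ 3 * Real.exp (-(δ * r)) :=
        mul_le_mul_of_nonneg_right hkey3 (Real.exp_pos _).le
    _ = (1 + 3 / δ) ^ 3 * (Real.exp (δ * r / 3) ^ 3 * Real.exp (-(δ * r))) := by ring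
    _ = (1 + 3 / δ) ^ 3 := by rw [hexp3, mul_one]

/-- **Decay of `H_0` on the real axis**: for every `b < π/8` there is `C > 0` with
`‖H_0(x)‖ ≤ C e^{−b|x|}` for all real `x`. From `H_0(x) = ξ(1/2 + ix/2)/8`
(`deBruijnH_zero_eq_holds`) and the Lagarias–Montague strip bound
`|ξ(s)| ≤ C₁ e^{−π|Im s|/4} (|Im s| + 1)^{5/2}` (`LagariasMontague2011_lem_3_3_i_holds`), the
polynomial factor being absorbed by `e^{−(π/8 − b)|x|}`. [cite: LagariasMontague2011, Lemma 3.3 (1)] -/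
theorem exists_norm_deBruijnH_zero_real_le_exp {b : ℝ} (hb : b < Real.pi / 8) :
    ∃ C : ℝ, 0 < C ∧ ∀ x : ℝ, ‖deBruijnH 0 (x : ℂ)‖ ≤ C * Real.exp (-(b * |x|)) := by
  obtain ⟨C₁, hC₁, hLM⟩ := LagariasMontague2011_lem_3_3_i_holds
  set δ : ℝ := Real.pi / 8 - b with hδ
  have hδ0 : 0 < δ := by rw [hδ]; linarith
  refine ⟨C₁ / 8 * (1 + 3 / δ) ^ 3, by positivity, fun x => ?_⟩
  set s : ℂ := 1 / 2 + Complex.I * x / 2 with hs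
  have hsre : s.re = 1 / 2 := by simp [hs]
  have hsim : s.im = x / 2 := by simp [hs]
  have hH : deBruijnH 0 (x : ℂ) = riemannXi s / 8 := by rw [deBruijnH_zero_eq_holds]
  have hξ := hLM s (by rw [hsre]) (by rw [hsre]; norm_num)
  rw [hsim] at hξ
  have habs : |x / 2| = |x| / 2 := by rw [abs_div, abs_two]
  rw [habs] at hξ
  rw [hH, norm_div, Complex.norm_ofNat]
  have hx0 : 0 ≤ |x| := abs_nonneg x
  -- `e^{−π|x|/8} (|x|/2+1)^{5/2} = e^{−b|x|} · ((|x|/2+1)^{5/2} e^{−δ|x|})`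
  have hsplit : Real.exp (-(Real.pi / 4) * (|x| / 2)) * (|x| / 2 + 1) ^ (5 / 2 : ℝ) =
      Real.exp (-(b * |x|)) * ((|x| / 2 + 1) ^ (5 / 2 : ℝ) * Real.exp (-(δ * |x|))) := by
    have : Real.exp (-(Real.pi / 4) * (|x| / 2)) = Real.exp (-(b * |x|)) * Real.exp (-(δ * |x|)) := by
      rw [← Real.exp_add]; congr 1; rw [hδ]; ring
    rw [this]; ring
  have hpoly := rpow_mul_exp_neg_le hδ0 hx0
  calc ‖riemannXi s‖ / 8 ≤ C₁ * Real.exp (-(Real.pi / 4) * (|x| / 2)) * (|x| / 2 + 1) ^ (5 / 2 : ℝ) / 8 := by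
        gcongr
    _ = C₁ / 8 * (Real.exp (-(b * |x|)) * ((|x| / 2 + 1) ^ (5 / 2 : ℝ) * Real.exp (-(δ * |x|)))) := by
        rw [mul_assoc, hsplit]; ring
    _ ≤ C₁ / 8 * (Real.exp (-(b * |x|)) * (1 + 3 / δ) ^ 3) := by gcongr
    _ = C₁ / 8 * (1 + 3 / δ) ^ 3 * Real.exp (-(b * |x|)) := by ring

/-! ## Integrability of `e^{aw} H_0(w)` for `a < π/8` -/

/-- For `0 ≤ a < π/8`, `w ↦ e^{a|w|} ‖H_0(w)‖` is integrable over `ℝ`. [folklore] -/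
theorem integrable_exp_mul_abs_mul_norm_deBruijnH_zero {a : ℝ} (hlt : a < Real.pi / 8) :
    Integrable fun w : ℝ => Real.exp (a * |w|) * ‖deBruijnH 0 (w : ℂ)‖ := by
  set b : ℝ := (a + Real.pi / 8) / 2 with hb
  have hb1 : b < Real.pi / 8 := by rw [hb]; linarith
  have hab : 0 < b - a := by rw [hb]; linarith
  obtain ⟨C, hC, hdec⟩ := exists_norm_deBruijnH_zero_real_le_exp hb1
  have hmeas : AEStronglyMeasurable (fun w : ℝ => Real.exp (a * |w|) * ‖deBruijnH 0 (w : ℂ)‖) volume := by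
    refine (Continuous.mul (by fun_prop) ?_).aestronglyMeasurable
    exact (continuous_deBruijnH_zero.comp Complex.continuous_ofReal).norm
  refine ((integrable_exp_neg_mul_abs hab).const_mul C).mono' hmeas (Eventually.of_forall fun w => ?_)
  rw [Real.norm_eq_abs, abs_of_nonneg (by positivity)]
  calc Real.exp (a * |w|) * ‖deBruijnH 0 (w : ℂ)‖ ≤ Real.exp (a * |w|) * (C * Real.exp (-(b * |w|))) := by
        gcongr; exact hdec w
    _ = C * Real.exp (-((b - a) * |w|)) := by
        rw [show -((b - a) * |w|) = a * |w| + -(b * |w|) by ring, Real.exp_add]; ring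

/-- For `0 < a < π/8`, `w ↦ (a/2) e^{aw} H_0(w)` is integrable over `ℝ` (`e^{aw} ≤ e^{a|w|}`). [folklore] -/
theorem integrable_exp_mul_deBruijnH_zero {a : ℝ} (ha : 0 < a) (hlt : a < Real.pi / 8) :
    Integrable fun w : ℝ => ((a / 2 * Real.exp (a * w) : ℝ) : ℂ) * deBruijnH 0 (w : ℂ) := by
  have hmeas : AEStronglyMeasurable
      (fun w : ℝ => ((a / 2 * Real.exp (a * w) : ℝ) : ℂ) * deBruijnH 0 (w : ℂ)) volume := by
    refine (Continuous.mul (by fun_prop) ?_).aestronglyMeasurable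
    exact continuous_deBruijnH_zero.comp Complex.continuous_ofReal
  refine (((integrable_exp_mul_abs_mul_norm_deBruijnH_zero hlt).const_mul (a / 2))).mono' hmeas
    (Eventually.of_forall fun w => ?_)
  rw [norm_mul, Complex.norm_real, Real.norm_eq_abs, abs_of_nonneg (by positivity), mul_assoc]
  gcongr
  exact le_abs_self w

/-- The limit value: `∫ℝ (a/2) e^{aw} H_0(w) dw = a ∫₀^∞ H_0(y) cosh(ay) dy` (split at `0`, `H_0` even).
[folklore] -/
theorem integral_exp_mul_deBruijnH_zero {a : ℝ} (ha : 0 < a) (hlt : a < Real.pi / 8) :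
    ∫ w : ℝ, ((a / 2 * Real.exp (a * w) : ℝ) : ℂ) * deBruijnH 0 (w : ℂ) =
      (a : ℂ) * ∫ y in Ioi (0:ℝ), deBruijnH 0 (y : ℂ) * (Real.cosh (a * y) : ℂ) := by
  set g : ℝ → ℂ := fun w => ((a / 2 * Real.exp (a * w) : ℝ) : ℂ) * deBruijnH 0 (w : ℂ) with hg
  have hgi : Integrable g := integrable_exp_mul_deBruijnH_zero ha hlt
  have h1 : ∫ w, g w = (∫ w in Iic (0:ℝ), g w) + ∫ w in Ioi (0:ℝ), g w := by
    rw [← setIntegral_union (Iic_disjoint_Ioi le_rfl) measurableSet_Ioi hgi.integrableOn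
      hgi.integrableOn, Iic_union_Ioi, Measure.restrict_univ]
  have h2 : ∫ w in Iic (0:ℝ), g w = ∫ w in Ioi (0:ℝ), g (-w) := by
    rw [integral_comp_neg_Ioi, neg_zero]
  have hgi' : IntegrableOn (fun w => g (-w)) (Ioi 0) := hgi.comp_neg.integrableOn
  rw [h1, h2, ← integral_add hgi' hgi.integrableOn, ← integral_const_mul]
  refine setIntegral_congr_fun measurableSet_Ioi fun w _ => ?_
  simp only [hg]
  rw [Complex.ofReal_neg, deBruijnH_neg, Real.cosh_eq]
  push_cast
  ring_nf

/-! ## The tail limit -/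

/-- `e^{ax} F_a(x) = ∫ℝ (a/2) e^{ax − a|x − w|} H_0(w) dw` for real `x` (`a > 0`): the convolution
formula after the substitution `w = x − y`. [folklore] -/
theorem exp_mul_deBruijnHDiv_laplace_eq_integral {a : ℝ} (ha : 0 < a) (x : ℝ) :
    (Real.exp (a * x) : ℂ) * deBruijnHDiv (fun u : ℝ => 1 + u ^ 2 / a ^ 2) x =
      ∫ w : ℝ, ((a / 2 * Real.exp (a * x - a * |x - w|) : ℝ) : ℂ) * deBruijnH 0 (w : ℂ) := by
  rw [deBruijnHDiv_laplace_ofReal_eq_conv ha x]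
  have hsub := integral_sub_left_eq_self
    (fun w : ℝ => ((a / 2 * Real.exp (-(a * |x - w|)) : ℝ) : ℂ) * deBruijnH 0 (w : ℂ)) volume x
  simp only [sub_sub_cancel] at hsub
  rw [hsub, ← integral_const_mul]
  refine integral_congr_ae (Eventually.of_forall fun w => ?_)
  simp only [sub_eq_add_neg (a * x), Real.exp_add]
  push_cast
  ring_nf

/-- **The wide-kernel tail** (dominated convergence): for `0 < a < π/8`,
`e^{ax} F_a(x) → a ∫₀^∞ H_0(y) cosh(ay) dy` as `x → +∞`. The integrand
`(a/2) e^{ax − a|x−w|} H_0(w)` is eventually constant `= (a/2)e^{aw}H_0(w)` in `x` for each `w` and is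
dominated by `(a/2) e^{aw} ‖H_0(w)‖`, integrable because `‖H_0(w)‖ ≪ e^{−b|w|}` for any `b < π/8`.
[folklore] -/
theorem tendsto_exp_mul_deBruijnHDiv_laplace {a : ℝ} (ha : 0 < a) (hlt : a < Real.pi / 8) :
    Tendsto (fun x : ℝ => (Real.exp (a * x) : ℂ) * deBruijnHDiv (fun u : ℝ => 1 + u ^ 2 / a ^ 2) x)
      atTop (𝓝 ((a : ℂ) * ∫ y in Ioi (0:ℝ), deBruijnH 0 (y : ℂ) * (Real.cosh (a * y) : ℂ))) := by
  rw [← integral_exp_mul_deBruijnH_zero ha hlt]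
  have heq : (fun x : ℝ => (Real.exp (a * x) : ℂ) * deBruijnHDiv (fun u : ℝ => 1 + u ^ 2 / a ^ 2) x) =
      fun x : ℝ => ∫ w : ℝ, ((a / 2 * Real.exp (a * x - a * |x - w|) : ℝ) : ℂ) * deBruijnH 0 (w : ℂ) :=
    funext fun x => exp_mul_deBruijnHDiv_laplace_eq_integral ha x
  rw [heq]
  refine tendsto_integral_filter_of_dominated_convergence
    (fun w : ℝ => a / 2 * Real.exp (a * w) * ‖deBruijnH 0 (w : ℂ)‖) ?_ ?_ ?_ ?_
  · refine Eventually.of_forall fun x => ?_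
    refine (Continuous.mul (by fun_prop) ?_).aestronglyMeasurable
    exact continuous_deBruijnH_zero.comp Complex.continuous_ofReal
  · refine Eventually.of_forall fun x => Eventually.of_forall fun w => ?_
    rw [norm_mul, Complex.norm_real, Real.norm_eq_abs, abs_of_nonneg (by positivity)]
    gcongr
    -- `a x − a|x − w| ≤ a w`
    have := le_abs_self (x - w)
    nlinarith
  · have h := (integrable_exp_mul_abs_mul_norm_deBruijnH_zero hlt).const_mul (a / 2)
    have hc : Continuous fun w : ℝ => a / 2 * Real.exp (a * w) * ‖deBruijnH 0 (w : ℂ)‖ :=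
      (Continuous.mul (by fun_prop) (continuous_deBruijnH_zero.comp Complex.continuous_ofReal).norm)
    refine h.mono' hc.aestronglyMeasurable (Eventually.of_forall fun w => ?_)
    rw [Real.norm_eq_abs, abs_of_nonneg (by positivity), mul_assoc]
    gcongr
    exact le_abs_self w
  · refine Eventually.of_forall fun w => ?_
    refine (tendsto_const_nhds (x := ((a / 2 * Real.exp (a * w) : ℝ) : ℂ) * deBruijnH 0 (w : ℂ))).congr' ?_
    filter_upwards [eventually_ge_atTop w] with x hx
    rw [abs_of_nonneg (sub_nonneg.2 hx)]
    congr 3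
    ring_nf

/-- **`WideKernelTail`** (route `UniversalFactor`, item stmt-RiemannHypothesis-2581, verbatim): for
`0 < a < π/8`, `e^{ax} F_a(x) → a ∫₀^∞ H_0(y) cosh(ay) dy` as `x → +∞`, where
`F_a(x) = ∫₀^∞ Φ(u)(1 + u²/a²)⁻¹ cos(xu) du`. [folklore] -/
theorem wideKernelTail : UniversalFactor.WideKernelTail := fun _ ha hlt =>
  tendsto_exp_mul_deBruijnHDiv_laplace ha hlt

end Summit.RiemannHypothesis.RiemannHypothesis.Theorems
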